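import Literature.Computability.QuantumComplexity.TraceInnerProductEstimation
import HarnessLib

/-!
# Trace inner products of COMPLEX matrices from `SQ_φ(A)` by realification (CGLLTW 2022, Remark 3.2 (a))

Chia, Gilyén, Li, Lin, Tang, Wang, J. ACM 69(5):33 (2022) = arXiv:1910.06151, **§3.2 Remark 3.2 (a)**
(held arXiv text p. 19 L45–64):

> (a) (Trace inner products, [GLT18]) Given `SQ_φ(A) ∈ ℂ^{n×n}` and `Q(B) ∈ ℂ^{n×n}`, we can
>     estimate `tr[AB†]` to additive error `ε` with probability at least `1−δ` by using
>     `O(φ ‖A‖_F²‖B‖_F² ε⁻² (sq_φ(A) + q(B)) log(1/δ))` time. To do this, note that `SQ_φ(A)` and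
>     `Q(B)` imply `SQ_φ(vec(A))` and `Q(vec(B))`. `tr[AB†] = ⟨vec(B), vec(A)⟩`, so we can just
>     apply (Lemma: inner product estimation) to conclude.

The tree's `SampleQuery.traceInnerProductEstimation` (file `TraceInnerProductEstimation.lean`) is
the REAL rectangular case.  This file supplies the complex statement by REALIFICATION, the standard
reduction `ℂ^{m×n} ∋ A ↦ Â = [Re A | Im A] ∈ ℝ^{m×2n}`:

* `realify A` and its bookkeeping: `frobSq_realify` (`‖Â‖_F² = Σ_{ij} |A_ij|² = ‖A‖_F²`),
  `trace_realify` (`tr(Â B̂ᵀ) = Re tr(A B†)`), `trace_mul_of_isHermitian` / `im_trace_mul_eq_zero`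
  (for Hermitian `A`, `B`: `tr(AB†) = tr(AB)` and it is real — the expectation-value case);
* `MatrixOversamplingWitness.realify` — `SQ_φ(A) ⇒ SQ_φ(Â)` with the SAME `φ`: from a complex
  dominating matrix `Ã` (`‖Ã‖_F² = φ‖A‖_F²`, `|A_ij| ≤ |Ã_ij|`) the real witness puts
  `|Ã_ij|·|Re A_ij|/|A_ij|` and `|Ã_ij|·|Im A_ij|/|A_ij|` on the two slots of `(i, j)` (all of
  `|Ã_ij|` on the real slot when `A_ij = 0`), i.e. sample `(i, j) ∼ Ã` then the slot in proportion
  `Re² : Im²` with one query — the content of "`SQ_φ(A)` … impl[ies] `SQ_φ(vec(A))`" for complex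
  entries;
* `traceInnerProductEstimation_complex` — Remark 3.2 (a) as printed, for `A, B ∈ ℂ^{m×n}`: the
  median-of-means estimator run on `(vec Â; vec B̂)` with `x ≥ 8φ‖A‖_F²‖B‖_F²/ε²` samples per block
  and `q ≥ 8 ln(1/δ)` blocks is `ε`-close to `Re tr(AB†)` except on outcomes of total weight `≤ δ`
  (the imaginary part is the same statement for `−iA`, not spelled out);
* `traceInnerProductEstimation_hermitian` — the square Hermitian case: `ε`-close to `tr(AB)`
  (real), the form in which expectation values `tr(ρ O)` are cited (cell pub-qadeq rows A-159 /
  A-13 / A-14).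

Everything is proved; no named facts.  The complex `SQ` access model itself is not a separate tree
notion: its content enters exactly through the hypotheses of `MatrixOversamplingWitness.realify`.

## References
* [ChiaEtAl2022] N.-H. Chia, A. Gilyén, T. Li, H.-H. Lin, E. Tang, C. Wang, J. ACM 69(5):33, 2022
  (= arXiv:1910.06151), §3.2 Remark 3.2 (a); §2.2 Def. 2.9 and the remark after it.
* [TangEwin2019] E. Tang, STOC 2019, Prop. 4.2 — via `InnerProductEstimation`.
* [Zhang2026] F. Zhang, *Matrix Theory: Basic Results and Techniques*, Universitext, Springer
  (doi:10.1007/978-1-0716-5238-1), §7.2 (the trace of a product of two Hermitian matrices is real).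
-/

noncomputable section

open scoped Matrix ComplexConjugate

namespace Literature.Computability.QuantumComplexity

namespace SampleQuery

open Finset Literature.Computability.Complexity

variable {m n : ℕ} {φ : ℝ}

/-! ### Realification `Â = [Re A | Im A]` -/

/-- The realification `Â ∈ ℝ^{m×2n}` of `A ∈ ℂ^{m×n}`: column `j` of the first block is `Re A(·,j)`,
of the second block `Im A(·,j)` (blocks glued by `finSumFinEquiv`). [cite: ChiaEtAl2022, §3.2
Remark 3.2 (a) (the reduction `tr[AB†] = ⟨vec(B), vec(A)⟩` over `ℂ`, made real)] -/
def realify (A : Matrix (Fin m) (Fin n) ℂ) : Matrix (Fin m) (Fin (n + n)) ℝ :=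
  Matrix.of fun i j => Sum.elim (fun j₁ => (A i j₁).re) (fun j₂ => (A i j₂).im)
    (finSumFinEquiv.symm j)

/-- First block: real parts. [cite: ChiaEtAl2022, §3.2 Remark 3.2 (a)] -/
@[simp] theorem realify_inl (A : Matrix (Fin m) (Fin n) ℂ) (i : Fin m) (j : Fin n) :
    realify A i (finSumFinEquiv (Sum.inl j)) = (A i j).re := by
  unfold realify
  rw [Matrix.of_apply, Equiv.symm_apply_apply]
  rfl

/-- Second block: imaginary parts. [cite: ChiaEtAl2022, §3.2 Remark 3.2 (a)] -/
@[simp] theorem realify_inr (A : Matrix (Fin m) (Fin n) ℂ) (i : Fin m) (j : Fin n) :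
    realify A i (finSumFinEquiv (Sum.inr j)) = (A i j).im := by
  unfold realify
  rw [Matrix.of_apply, Equiv.symm_apply_apply]
  rfl

/-- Sums over `Fin (n + n)` split into the two blocks. [folklore] -/
private theorem sum_fin_add (F : Fin (n + n) → ℝ) :
    ∑ j, F j = ∑ j : Fin n, F (finSumFinEquiv (Sum.inl j)) +
      ∑ j : Fin n, F (finSumFinEquiv (Sum.inr j)) := by
  rw [← Equiv.sum_comp finSumFinEquiv, Fintype.sum_sum_type]

/-- Row norms: `‖Â(i,·)‖² = Σ_j |A(i,j)|²`. [cite: ChiaEtAl2022, §3.2 Remark 3.2 (a)] -/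
theorem normSq_realify_row (A : Matrix (Fin m) (Fin n) ℂ) (i : Fin m) :
    normSq (realify A i) = ∑ j, Complex.normSq (A i j) := by
  unfold normSq
  rw [sum_fin_add, ← sum_add_distrib]
  refine sum_congr rfl fun j _ => ?_
  rw [realify_inl, realify_inr, Complex.normSq_apply]
  ring

/-- **`‖Â‖_F² = ‖A‖_F²`** (`= Σ_{ij} |A_ij|²`). [cite: ChiaEtAl2022, §3.2 Remark 3.2 (a)] -/
theorem frobSq_realify (A : Matrix (Fin m) (Fin n) ℂ) :
    frobSq (realify A) = ∑ i, ∑ j, Complex.normSq (A i j) := by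
  unfold frobSq
  exact sum_congr rfl fun i _ => normSq_realify_row A i

/-- `Σ_{ij} Â_ij B̂_ij = Re Σ_{ij} A_ij conj(B_ij)`. [cite: ChiaEtAl2022, §3.2 Remark 3.2 (a)] -/
theorem sum_realify_mul_realify (A B : Matrix (Fin m) (Fin n) ℂ) :
    ∑ i, ∑ j, realify A i j * realify B i j = (∑ i, ∑ j, A i j * conj (B i j)).re := by
  rw [Complex.re_sum]
  refine sum_congr rfl fun i _ => ?_
  rw [Complex.re_sum, sum_fin_add, ← sum_add_distrib]
  refine sum_congr rfl fun j _ => ?_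
  rw [realify_inl, realify_inr, realify_inl, realify_inr, Complex.mul_re, Complex.conj_re,
    Complex.conj_im]
  ring

/-- **`tr(Â B̂ᵀ) = Re tr(A B†)`**. [cite: ChiaEtAl2022, §3.2 Remark 3.2 (a)
("`tr[AB†] = ⟨vec(B), vec(A)⟩`")] -/
theorem trace_realify (A B : Matrix (Fin m) (Fin n) ℂ) :
    (realify A * (realify B)ᵀ).trace = ((A * Bᴴ).trace).re := by
  have e : (A * Bᴴ).trace = ∑ i, ∑ j, A i j * conj (B i j) := by
    simp only [Matrix.trace, Matrix.diag_apply, Matrix.mul_apply, Matrix.conjTranspose_apply,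
      Complex.star_def]
  rw [trace_mul_transpose, sum_realify_mul_realify, e]

/-- For Hermitian `B`: `tr(AB†) = tr(AB)`. [cite: Zhang2026, §7.2 (opening display,
`tr(AB) = tr(A^*B^*)` for Hermitian `A`, `B`), held text p0133] -/
theorem trace_mul_conjTranspose_of_isHermitian {k : ℕ} (A : Matrix (Fin k) (Fin k) ℂ)
    {B : Matrix (Fin k) (Fin k) ℂ} (hB : B.IsHermitian) : (A * Bᴴ).trace = (A * B).trace := by
  rw [hB.eq]

/-- **"The trace of a product of two Hermitian matrices is always real"**:
`tr(AB) = tr(A^*B^*) = conj tr(BA) = conj tr(AB)`. [cite: Zhang2026, §7.2 (opening paragraph and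
display), held text p0133–p0134] -/
theorem im_trace_mul_eq_zero {k : ℕ} {A B : Matrix (Fin k) (Fin k) ℂ} (hA : A.IsHermitian)
    (hB : B.IsHermitian) : ((A * B).trace).im = 0 := by
  have h : star ((A * B).trace) = (A * B).trace := by
    rw [← Matrix.trace_conjTranspose, Matrix.conjTranspose_mul, hA.eq, hB.eq, Matrix.trace_mul_comm]
  rw [Complex.star_def] at h
  have := congrArg Complex.im h
  rw [Complex.conj_im] at this
  linarith

/-- `A ≠ 0 ⇒ Â ≠ 0`. [folklore] -/
private theorem realify_ne_zero {A : Matrix (Fin m) (Fin n) ℂ} (hA : A ≠ 0) : realify A ≠ 0 := by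
  intro h
  apply hA
  ext i j
  have h1 := congr_fun (congr_fun h i) (finSumFinEquiv (Sum.inl j))
  have h2 := congr_fun (congr_fun h i) (finSumFinEquiv (Sum.inr j))
  rw [realify_inl, Matrix.zero_apply] at h1
  rw [realify_inr, Matrix.zero_apply] at h2
  rw [Matrix.zero_apply]
  apply Complex.ext <;> simp [h1, h2]

/-! ### `SQ_φ(A)` over `ℂ` gives `SQ_φ(Â)` -/

namespace MatrixOversamplingWitness

/-- The real dominating matrix built from a complex one: on the slots of `(i, j)` put
`|Ã_ij|·|Re A_ij|/|A_ij|` and `|Ã_ij|·|Im A_ij|/|A_ij|` (`|Ã_ij|` and `0` if `A_ij = 0`).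
[cite: ChiaEtAl2022, §2.2 remark after Def. 2.9 and §3.2 Remark 3.2 (a)
("`SQ_φ(A)` and `Q(B)` imply `SQ_φ(vec(A))`")] -/
def realifyTilde (A T : Matrix (Fin m) (Fin n) ℂ) : Matrix (Fin m) (Fin (n + n)) ℝ :=
  Matrix.of fun i j => Sum.elim
    (fun j₁ => if A i j₁ = 0 then ‖T i j₁‖ else ‖T i j₁‖ * |(A i j₁).re| / ‖A i j₁‖)
    (fun j₂ => if A i j₂ = 0 then 0 else ‖T i j₂‖ * |(A i j₂).im| / ‖A i j₂‖)
    (finSumFinEquiv.symm j)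

/-- First-block entries of `realifyTilde`. [folklore] -/
private theorem realifyTilde_inl (A T : Matrix (Fin m) (Fin n) ℂ) (i : Fin m) (j : Fin n) :
    realifyTilde A T i (finSumFinEquiv (Sum.inl j)) =
      (if A i j = 0 then ‖T i j‖ else ‖T i j‖ * |(A i j).re| / ‖A i j‖) := by
  unfold realifyTilde
  rw [Matrix.of_apply, Equiv.symm_apply_apply]
  rfl

/-- Second-block entries of `realifyTilde`. [folklore] -/
private theorem realifyTilde_inr (A T : Matrix (Fin m) (Fin n) ℂ) (i : Fin m) (j : Fin n) :
    realifyTilde A T i (finSumFinEquiv (Sum.inr j)) =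
      (if A i j = 0 then 0 else ‖T i j‖ * |(A i j).im| / ‖A i j‖) := by
  unfold realifyTilde
  rw [Matrix.of_apply, Equiv.symm_apply_apply]
  rfl

/-- The two slots of `(i, j)` carry total squared mass `|Ã_ij|²`. [folklore] -/
private theorem realifyTilde_sq_add (A T : Matrix (Fin m) (Fin n) ℂ) (i : Fin m) (j : Fin n) :
    realifyTilde A T i (finSumFinEquiv (Sum.inl j)) ^ 2 +
      realifyTilde A T i (finSumFinEquiv (Sum.inr j)) ^ 2 = ‖T i j‖ ^ 2 := by
  rw [realifyTilde_inl, realifyTilde_inr]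
  by_cases h : A i j = 0
  · rw [if_pos h, if_pos h]; ring
  · rw [if_neg h, if_neg h]
    have hn : ‖A i j‖ ≠ 0 := norm_ne_zero_iff.mpr h
    have hsq : (A i j).re ^ 2 + (A i j).im ^ 2 = ‖A i j‖ ^ 2 := by
      rw [Complex.sq_norm, Complex.normSq_apply]; ring
    rw [div_pow, div_pow, mul_pow, mul_pow, sq_abs, sq_abs, ← add_div, ← mul_add, hsq,
      mul_div_assoc, div_self (pow_ne_zero 2 hn), mul_one]

/-- **`SQ_φ(A)` over `ℂ` gives `SQ_φ(Â)`** with the same `φ`: a complex dominating matrix `Ã`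
(`‖Ã‖_F² = φ‖A‖_F²`, `|A_ij| ≤ |Ã_ij|`) yields a real oversampling witness for `Â`.
[cite: ChiaEtAl2022, §2.2 Def. 2.9 with the remark after it, §3.2 Remark 3.2 (a)] -/
def realify {A : Matrix (Fin m) (Fin n) ℂ} (T : Matrix (Fin m) (Fin n) ℂ)
    (hfrob : ∑ i, ∑ j, Complex.normSq (T i j) = φ * ∑ i, ∑ j, Complex.normSq (A i j))
    (hdom : ∀ i j, ‖A i j‖ ≤ ‖T i j‖) :
    MatrixOversamplingWitness φ (SampleQuery.realify A) where
  tilde := realifyTilde A T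
  frobSq_tilde := by
    rw [frobSq_realify, ← hfrob]
    unfold frobSq normSq
    refine sum_congr rfl fun i _ => ?_
    rw [sum_fin_add, ← sum_add_distrib]
    refine sum_congr rfl fun j _ => ?_
    rw [realifyTilde_sq_add, Complex.normSq_eq_norm_sq]
  sq_le i j := by
    obtain ⟨s, rfl⟩ := finSumFinEquiv.surjective j
    rcases s with j | j
    · rw [realify_inl, realifyTilde_inl]
      by_cases h : A i j = 0
      · rw [if_pos h, h, Complex.zero_re, zero_pow two_ne_zero]
        exact sq_nonneg _
      · rw [if_neg h]
        have hn : 0 < ‖A i j‖ := norm_pos_iff.mpr h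
        have hre : |(A i j).re| ≤ ‖A i j‖ := Complex.abs_re_le_norm _
        rw [div_pow, mul_pow, sq_abs, le_div_iff₀ (by positivity)]
        calc (A i j).re ^ 2 * ‖A i j‖ ^ 2 ≤ (A i j).re ^ 2 * ‖T i j‖ ^ 2 := by
              gcongr
              exact hdom i j
          _ = ‖T i j‖ ^ 2 * (A i j).re ^ 2 := by ring
    · rw [realify_inr, realifyTilde_inr]
      by_cases h : A i j = 0
      · rw [if_pos h, h, Complex.zero_im]
      · rw [if_neg h]
        have hn : 0 < ‖A i j‖ := norm_pos_iff.mpr h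
        rw [div_pow, mul_pow, sq_abs, le_div_iff₀ (by positivity)]
        calc (A i j).im ^ 2 * ‖A i j‖ ^ 2 ≤ (A i j).im ^ 2 * ‖T i j‖ ^ 2 := by
              gcongr
              exact hdom i j
          _ = ‖T i j‖ ^ 2 * (A i j).im ^ 2 := by ring

end MatrixOversamplingWitness

/-! ### Remark 3.2 (a) for complex matrices -/

/-- **Trace inner product estimation, complex entries** (CGLLTW Remark 3.2 (a) as printed): given
`SQ_φ(Â)` (e.g. from `SQ_φ(A)` via `MatrixOversamplingWitness.realify`), `A ≠ 0`, and query access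
to `B ∈ ℂ^{m×n}`, the median-of-means inner-product estimator on `(vec Â; vec B̂)` with `q` blocks
of `x ≥ 8φ‖A‖_F²‖B‖_F²/ε²` samples, `q ≥ 8 ln(1/δ)`, is `ε`-close to `Re tr(AB†)` except on
outcomes of total weight `≤ δ`. [cite: ChiaEtAl2022, §3.2 Remark 3.2 (a)] -/
theorem traceInnerProductEstimation_complex {A : Matrix (Fin m) (Fin n) ℂ}
    (W : MatrixOversamplingWitness φ (realify A)) (hA : A ≠ 0) (B : Matrix (Fin m) (Fin n) ℂ)
    {x q : ℕ} (hx : 0 < x) (hq : 0 < q) {ε δ : ℝ} (hε : 0 < ε) (hδ : 0 < δ)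
    (hxε : 8 * φ * (∑ i, ∑ j, Complex.normSq (A i j)) * (∑ i, ∑ j, Complex.normSq (B i j)) / ε ^ 2
      ≤ x)
    (hqδ : 8 * Real.log (1 / δ) ≤ q) (med : (Fin q → Fin x → Fin (m * (n + n))) → ℝ)
    (hmed : ∀ ω, IsMedian (fun i => ipBlockMean W.vec (vecOf (realify B)) (ω i)) (med ω)) :
    ∑ ω ∈ univ.filter
        (fun ω : Fin q → Fin x → Fin (m * (n + n)) => ε ≤ |med ω - ((A * Bᴴ).trace).re|),
      ∏ i, iidWeight (lengthSqDist (vecOf W.tilde)) (ω i) ≤ δ := by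
  have hxε' : 8 * φ * frobSq (realify A) * frobSq (realify B) / ε ^ 2 ≤ x := by
    rwa [frobSq_realify, frobSq_realify]
  have h := traceInnerProductEstimation W (realify_ne_zero hA) (realify B) hx hq hε hδ hxε' hqδ
    med hmed
  simp_rw [trace_realify] at h
  exact h

/-- **The Hermitian (expectation-value) case**: for Hermitian `A, B ∈ ℂ^{k×k}` the same estimator is
`ε`-close to `tr(AB)` (a real number: `im_trace_mul_eq_zero`) except on weight `≤ δ`, with
`x ≥ 8φ‖A‖_F²‖B‖_F²/ε²`, `q ≥ 8 ln(1/δ)` — the form used for `tr(ρ O)`.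
[cite: ChiaEtAl2022, §3.2 Remark 3.2 (a)] -/
theorem traceInnerProductEstimation_hermitian {k : ℕ} {A B : Matrix (Fin k) (Fin k) ℂ}
    (hB : B.IsHermitian) (W : MatrixOversamplingWitness φ (realify A))
    (hA : A ≠ 0) {x q : ℕ} (hx : 0 < x) (hq : 0 < q) {ε δ : ℝ} (hε : 0 < ε) (hδ : 0 < δ)
    (hxε : 8 * φ * (∑ i, ∑ j, Complex.normSq (A i j)) * (∑ i, ∑ j, Complex.normSq (B i j)) / ε ^ 2
      ≤ x)
    (hqδ : 8 * Real.log (1 / δ) ≤ q) (med : (Fin q → Fin x → Fin (k * (k + k))) → ℝ)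
    (hmed : ∀ ω, IsMedian (fun i => ipBlockMean W.vec (vecOf (realify B)) (ω i)) (med ω)) :
    ∑ ω ∈ univ.filter
        (fun ω : Fin q → Fin x → Fin (k * (k + k)) => ε ≤ |med ω - ((A * B).trace).re|),
      ∏ i, iidWeight (lengthSqDist (vecOf W.tilde)) (ω i) ≤ δ := by
  have h := traceInnerProductEstimation_complex W hA B hx hq hε hδ hxε hqδ med hmed
  simp_rw [trace_mul_conjTranspose_of_isHermitian A hB] at h
  exact h

end SampleQuery

end Literature.Computability.QuantumComplexity

end
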